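import Summits.CriticalPhenomena.PercolationContinuityZ3.Theorems.PercNearOneGluingNoHeavyConstsCrossReachMarkerPinned
import Summits.CriticalPhenomena.PercolationContinuityZ3.Theorems.PercNearOneGluingNoHeavyConstsSourceLocalFourEvents
import HarnessLib

/-!
# CROSS at the reach marker `u = z`, marker-pinned class: the three exchange inequalities, and `M₂ ≥ 0` unconditionally
# (PAPER-2 track (ii), seat `prim-consts-2`, gen 21 — companion of `…ConstsCrossReachMarkerPinned.lean`)

builds on p205010 (kernel theorem, internal audit signed; external expert review pending).  Support file (`--supports
stmt-CriticalPhenomena-4575`); theorems only, no sorries, standard axioms.  Memo `run/shared/lean/prim/consts/FROM-prim-consts-2-g21-GIBBS-ORBIT.md` §3.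

`…ConstsCrossReachMarkerPinned.lean` proves the CROSS member `M₂ ≥ 0` at `u = z` on the marker-pinned class (`F = 1{V(C_s) ∈ 𝒰}`, `𝒰` monotone,
`𝒰 S → y ∈ S`) from three exchange inequalities `hG1, hG2, hG3`.  This file proves them — each is an instance of the tree's
`Consts.localEv_fourEvents` (van den Berg–Häggström–Kahn's induction for source-local events, source set `{s, y}` in both factors):
* `Consts.markerPinned_exchange_G1` — `μ(s↔y, s↮X, U)·μ(y↔z, y↮s, {s,y}↮X) ≤ μ(y↮s, s↮z, {s,y}↮X)·μ(s↔y, s↔z, s↮X, U)`: a configuration of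
  `{s↔y, U}` and one of `{y↔z, y↮s}` MEET in `{y↮s, s↮z}` (both facts already hold in the second factor) and JOIN in `{s↔y↔z, U}`;
* `Consts.markerPinned_exchange_G2` — `μ({s,y}↮X, z ∈ C_s∪C_y)·μ(s↔y, s↮X, U) ≤ μ({s,y}↮X)·μ(s↔y, s↔z, s↮X, U)` (positive association of the
  cluster of the set `{s,y}` given `{s,y} ↮ X`, van den Berg–Häggström–Kahn Thm 1.3 with sets);
* `Consts.markerPinned_exchange_G3` — the same with the decreasing rider `y ↮ s` on the first factor and on the meet;
* `Consts.markerPinned_exchange_Ga/Gc/Ge` — the three exchanges of the `M₁` certificate (`…CrossReachMarkerPinnedM1.lean`): `(D∩Y∩U∖Z) × T → T' × (D∩Y∩U)`,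
  `(D∩Y∩U∖Z) × (E₁∖U) → (E₁∖Z∖W∖U) × (D∩Y∩U)` (sources `{s,y}`), `(D∩Y∩U∖Z) × (D∩Z∖U) → (D∖Z∖U) × (D∩Y∩Z∩U)` (sources `{s,y}` and `{s}`);
* `Consts.crossRel_reach_M1_of_markerPinned` — `M₁ ≥ 0` on the marker-pinned class, unconditionally;
* `Consts.crossRel_reach_M2_of_markerPinned` — **THEOREM: `P(X',X',X) + P(X',X,X') + P(X,X',X') ≥ 0` (`X' = X ∪ {z}`) for every weighted graph, all
  `s, y, z, X`, every monotone `𝒰` with `𝒰 S → y ∈ S`, and every `F` reading `1{𝒰(V(C_s))}` on the clusters** — the `u = z` member `M₂` of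
  `Consts.CrossRel` on the whole marker-pinned quadrant, unconditionally.
[cite: VandenbergHaggstromKahn2005, Thm. 1.1 and its proof (pp. 3–5), Thm. 1.3 (p. 6) with Remark 1 after Thm. 1.2 (p. 5)]
-/

noncomputable section

namespace Summit.CriticalPhenomena.PercolationContinuityZ3.Theorems

open MeasureTheory Set Finset
open Literature.Probability.LatticeModels (prodBernoulli)
open Literature.Probability.Percolation
open scoped Classical

namespace Consts

variable {V : Type} [DecidableEq V] [Fintype V] (w : Sym2 V → unitInterval)

omit [DecidableEq V] [Fintype V] in
/-- Reachability in the open graph is monotone in the configuration. [folklore] -/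
private theorem reach_mono' {ω ω' : BondConfig V} (h : ω ⊆ ω') {u v : V} (huv : (openGraph ω).Reachable u v) :
    (openGraph ω').Reachable u v :=
  huv.mono (BHK2006.openGraph_le h)

omit [DecidableEq V] [Fintype V] in
/-- The reach profile at a source. [folklore] -/
private theorem reachOf_apply' {S : Finset V} {ω : BondConfig V} {v : V} (hv : v ∈ S) :
    reachOf S ω v = {u | (openGraph ω).Reachable v u} := by
  ext u; exact ⟨fun h => h.2, fun h => ⟨hv, h⟩⟩

/-- **Generator `G₁` (exchange with an up-set rider across the conditionings `{s↔y}` / `{y↮s}`).**  For a monotone vertex-up-family `𝒰`: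
`μ(s↔y, s↮X, 𝒰(V C_s)) · μ(y↔z, y↮s, y↮X, s↮X) ≤ μ(y↮s, s↮z, y↮X, s↮X) · μ(s↔y, s↔z, s↮X, 𝒰(V C_s))`.
[cite: VandenbergHaggstromKahn2005, Thm. 1.1 and its proof (pp. 3–5) — instance of `Consts.localEv_fourEvents`, derived here] -/
theorem markerPinned_exchange_G1 (s y z : V) (X : Set V) {𝒰 : Set V → Prop} (h𝒰 : Monotone 𝒰) :
    (prodBernoulli w).real {ω : BondConfig V | (openGraph ω).Reachable s y ∧ (∀ x ∈ X, ¬ (openGraph ω).Reachable s x) ∧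
        𝒰 {v | (openGraph ω).Reachable s v}} *
      (prodBernoulli w).real {ω : BondConfig V | (openGraph ω).Reachable y z ∧ ¬ (openGraph ω).Reachable y s ∧
        (∀ x ∈ X, ¬ (openGraph ω).Reachable y x) ∧ (∀ x ∈ X, ¬ (openGraph ω).Reachable s x)} ≤
    (prodBernoulli w).real {ω : BondConfig V | ¬ (openGraph ω).Reachable y s ∧ ¬ (openGraph ω).Reachable s z ∧
        (∀ x ∈ X, ¬ (openGraph ω).Reachable y x) ∧ (∀ x ∈ X, ¬ (openGraph ω).Reachable s x)} *
      (prodBernoulli w).real {ω : BondConfig V | (openGraph ω).Reachable s y ∧ (openGraph ω).Reachable s z ∧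
        (∀ x ∈ X, ¬ (openGraph ω).Reachable s x) ∧ 𝒰 {v | (openGraph ω).Reachable s v}} := by
  set S : Finset V := {s, y} with hSdef
  have hsS : s ∈ S := by simp [hSdef]
  have hyS : y ∈ S := by simp [hSdef]
  have hRs : ∀ ω : BondConfig V, reachOf S ω s = {v | (openGraph ω).Reachable s v} := fun ω => reachOf_apply' hsS
  have hRy : ∀ ω : BondConfig V, reachOf S ω y = {v | (openGraph ω).Reachable y v} := fun ω => reachOf_apply' hyS
  have hball : ∀ (P : V → Prop), (∀ s' ∈ S, P s') ↔ (P s ∧ P y) := fun P => by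
    simp only [hSdef, Finset.mem_insert, Finset.mem_singleton, forall_eq_or_imp, forall_eq]
  let Φ₁ : (V → Set V) → Prop := fun R => y ∈ R s ∧ 𝒰 (R s)
  let Φ₂ : (V → Set V) → Prop := fun R => z ∈ R y ∧ s ∉ R y
  let Φ₃ : (V → Set V) → Prop := fun R => s ∉ R y ∧ z ∉ R s
  let Φ₄ : (V → Set V) → Prop := fun R => y ∈ R s ∧ z ∈ R s ∧ 𝒰 (R s)
  have hAD : ∀ ω ω' : BondConfig V, Φ₁ (reachOf S ω) → Φ₂ (reachOf S ω') →
      Φ₃ (reachOf (S ∩ S) (ω ∩ ω')) ∧ Φ₄ (reachOf (S ∪ S) (ω ∪ ω')) := by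
    intro ω ω' h1 h2
    simp only [Φ₁, Φ₂, Φ₃, Φ₄, Finset.inter_self, Finset.union_self, hRs, hRy, Set.mem_setOf_eq] at h1 h2 ⊢
    obtain ⟨hsy, hU⟩ := h1
    obtain ⟨hyz, hys⟩ := h2
    refine ⟨⟨fun h => hys (reach_mono' Set.inter_subset_right h),
      fun h => hys (hyz.trans (reach_mono' Set.inter_subset_right h).symm)⟩,
      reach_mono' Set.subset_union_left hsy,
      (reach_mono' Set.subset_union_left hsy).trans (reach_mono' Set.subset_union_right hyz),
      h𝒰 (fun v (hv : (openGraph ω).Reachable s v) => reach_mono' Set.subset_union_left hv) hU⟩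
  have key := localEv_fourEvents w S S hAD X X
  rw [Finset.inter_self, Finset.union_self, Set.union_self, Set.inter_self] at key
  have e1 : ({ω : BondConfig V | Φ₁ (reachOf S ω)} ∩ {ω | ∀ s' ∈ S, ∀ x ∈ X, ω ∉ openConn s' x}) =
      {ω : BondConfig V | (openGraph ω).Reachable s y ∧ (∀ x ∈ X, ¬ (openGraph ω).Reachable s x) ∧
        𝒰 {v | (openGraph ω).Reachable s v}} := by
    ext ω
    simp only [Φ₁, Set.mem_inter_iff, Set.mem_setOf_eq, hRs, hball, openConn]
    constructor
    · rintro ⟨⟨hsy, hU⟩, hsX, -⟩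
      exact ⟨hsy, hsX, hU⟩
    · rintro ⟨hsy, hsX, hU⟩
      exact ⟨⟨hsy, hU⟩, hsX, fun x hx h' => hsX x hx (hsy.trans h')⟩
  have e2 : ({ω : BondConfig V | Φ₂ (reachOf S ω)} ∩ {ω | ∀ s' ∈ S, ∀ x ∈ X, ω ∉ openConn s' x}) =
      {ω : BondConfig V | (openGraph ω).Reachable y z ∧ ¬ (openGraph ω).Reachable y s ∧
        (∀ x ∈ X, ¬ (openGraph ω).Reachable y x) ∧ (∀ x ∈ X, ¬ (openGraph ω).Reachable s x)} := by
    ext ω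
    simp only [Φ₂, Set.mem_inter_iff, Set.mem_setOf_eq, hRy, hball, openConn]
    tauto
  have e3 : ({ω : BondConfig V | Φ₃ (reachOf S ω)} ∩ {ω | ∀ s' ∈ S, ∀ x ∈ X, ω ∉ openConn s' x}) =
      {ω : BondConfig V | ¬ (openGraph ω).Reachable y s ∧ ¬ (openGraph ω).Reachable s z ∧
        (∀ x ∈ X, ¬ (openGraph ω).Reachable y x) ∧ (∀ x ∈ X, ¬ (openGraph ω).Reachable s x)} := by
    ext ω
    simp only [Φ₃, Set.mem_inter_iff, Set.mem_setOf_eq, hRs, hRy, hball, openConn]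
    tauto
  have e4 : ({ω : BondConfig V | Φ₄ (reachOf S ω)} ∩ {ω | ∀ s' ∈ S, ∀ x ∈ X, ω ∉ openConn s' x}) =
      {ω : BondConfig V | (openGraph ω).Reachable s y ∧ (openGraph ω).Reachable s z ∧
        (∀ x ∈ X, ¬ (openGraph ω).Reachable s x) ∧ 𝒰 {v | (openGraph ω).Reachable s v}} := by
    ext ω
    simp only [Φ₄, Set.mem_inter_iff, Set.mem_setOf_eq, hRs, hball, openConn]
    constructor
    · rintro ⟨⟨hsy, hsz, hU⟩, hsX, -⟩
      exact ⟨hsy, hsz, hsX, hU⟩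
    · rintro ⟨hsy, hsz, hsX, hU⟩
      exact ⟨⟨hsy, hsz, hU⟩, hsX, fun x hx h' => hsX x hx (hsy.trans h')⟩
  rw [e1, e2, e3, e4] at key
  exact key

/-- **Generator `G₂` (positive association of the cluster of `{s,y}` given `{s,y} ↮ X`, with an up-set rider).**  For a monotone
vertex-up-family `𝒰`:  `μ(z ∈ C_s ∪ C_y, s↮X, y↮X) · μ(s↔y, s↮X, 𝒰(V C_s)) ≤ μ(s↮X, y↮X) · μ(s↔y, s↔z, s↮X, 𝒰(V C_s))`.
[cite: VandenbergHaggstromKahn2005, Thm. 1.3 (p. 6) with Remark 1 after Thm. 1.2 (p. 5) — instance of `Consts.localEv_fourEvents`, derived here] -/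
theorem markerPinned_exchange_G2 (s y z : V) (X : Set V) {𝒰 : Set V → Prop} (h𝒰 : Monotone 𝒰) :
    (prodBernoulli w).real {ω : BondConfig V | ((openGraph ω).Reachable s z ∨ (openGraph ω).Reachable y z) ∧
        (∀ x ∈ X, ¬ (openGraph ω).Reachable y x) ∧ (∀ x ∈ X, ¬ (openGraph ω).Reachable s x)} *
      (prodBernoulli w).real {ω : BondConfig V | (openGraph ω).Reachable s y ∧ (∀ x ∈ X, ¬ (openGraph ω).Reachable s x) ∧
        𝒰 {v | (openGraph ω).Reachable s v}} ≤
    (prodBernoulli w).real {ω : BondConfig V | (∀ x ∈ X, ¬ (openGraph ω).Reachable y x) ∧ (∀ x ∈ X, ¬ (openGraph ω).Reachable s x)} *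
      (prodBernoulli w).real {ω : BondConfig V | (openGraph ω).Reachable s y ∧ (openGraph ω).Reachable s z ∧
        (∀ x ∈ X, ¬ (openGraph ω).Reachable s x) ∧ 𝒰 {v | (openGraph ω).Reachable s v}} := by
  set S : Finset V := {s, y} with hSdef
  have hsS : s ∈ S := by simp [hSdef]
  have hyS : y ∈ S := by simp [hSdef]
  have hRs : ∀ ω : BondConfig V, reachOf S ω s = {v | (openGraph ω).Reachable s v} := fun ω => reachOf_apply' hsS
  have hRy : ∀ ω : BondConfig V, reachOf S ω y = {v | (openGraph ω).Reachable y v} := fun ω => reachOf_apply' hyS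
  have hball : ∀ (P : V → Prop), (∀ s' ∈ S, P s') ↔ (P s ∧ P y) := fun P => by
    simp only [hSdef, Finset.mem_insert, Finset.mem_singleton, forall_eq_or_imp, forall_eq]
  let Φ₁ : (V → Set V) → Prop := fun R => z ∈ R s ∨ z ∈ R y
  let Φ₂ : (V → Set V) → Prop := fun R => y ∈ R s ∧ 𝒰 (R s)
  let Φ₃ : (V → Set V) → Prop := fun _ => True
  let Φ₄ : (V → Set V) → Prop := fun R => y ∈ R s ∧ z ∈ R s ∧ 𝒰 (R s)
  have hAD : ∀ ω ω' : BondConfig V, Φ₁ (reachOf S ω) → Φ₂ (reachOf S ω') →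
      Φ₃ (reachOf (S ∩ S) (ω ∩ ω')) ∧ Φ₄ (reachOf (S ∪ S) (ω ∪ ω')) := by
    intro ω ω' h1 h2
    simp only [Φ₁, Φ₂, Φ₃, Φ₄, Finset.inter_self, Finset.union_self, hRs, hRy, Set.mem_setOf_eq, true_and] at h1 h2 ⊢
    obtain ⟨hsy, hU⟩ := h2
    refine ⟨reach_mono' Set.subset_union_right hsy, ?_,
      h𝒰 (fun v (hv : (openGraph ω').Reachable s v) => reach_mono' Set.subset_union_right hv) hU⟩
    rcases h1 with hsz | hyz
    · exact reach_mono' Set.subset_union_left hsz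
    · exact (reach_mono' Set.subset_union_right hsy).trans (reach_mono' Set.subset_union_left hyz)
  have key := localEv_fourEvents w S S hAD X X
  rw [Finset.inter_self, Finset.union_self, Set.union_self, Set.inter_self] at key
  have e1 : ({ω : BondConfig V | Φ₁ (reachOf S ω)} ∩ {ω | ∀ s' ∈ S, ∀ x ∈ X, ω ∉ openConn s' x}) =
      {ω : BondConfig V | ((openGraph ω).Reachable s z ∨ (openGraph ω).Reachable y z) ∧
        (∀ x ∈ X, ¬ (openGraph ω).Reachable y x) ∧ (∀ x ∈ X, ¬ (openGraph ω).Reachable s x)} := by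
    ext ω
    simp only [Φ₁, Set.mem_inter_iff, Set.mem_setOf_eq, hRs, hRy, hball, openConn]
    tauto
  have e2 : ({ω : BondConfig V | Φ₂ (reachOf S ω)} ∩ {ω | ∀ s' ∈ S, ∀ x ∈ X, ω ∉ openConn s' x}) =
      {ω : BondConfig V | (openGraph ω).Reachable s y ∧ (∀ x ∈ X, ¬ (openGraph ω).Reachable s x) ∧
        𝒰 {v | (openGraph ω).Reachable s v}} := by
    ext ω
    simp only [Φ₂, Set.mem_inter_iff, Set.mem_setOf_eq, hRs, hball, openConn]
    constructor
    · rintro ⟨⟨hsy, hU⟩, hsX, -⟩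
      exact ⟨hsy, hsX, hU⟩
    · rintro ⟨hsy, hsX, hU⟩
      exact ⟨⟨hsy, hU⟩, hsX, fun x hx h' => hsX x hx (hsy.trans h')⟩
  have e3 : ({ω : BondConfig V | Φ₃ (reachOf S ω)} ∩ {ω | ∀ s' ∈ S, ∀ x ∈ X, ω ∉ openConn s' x}) =
      {ω : BondConfig V | (∀ x ∈ X, ¬ (openGraph ω).Reachable y x) ∧ (∀ x ∈ X, ¬ (openGraph ω).Reachable s x)} := by
    ext ω
    simp only [Φ₃, Set.mem_inter_iff, Set.mem_setOf_eq, hball, openConn, true_and]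
    tauto
  have e4 : ({ω : BondConfig V | Φ₄ (reachOf S ω)} ∩ {ω | ∀ s' ∈ S, ∀ x ∈ X, ω ∉ openConn s' x}) =
      {ω : BondConfig V | (openGraph ω).Reachable s y ∧ (openGraph ω).Reachable s z ∧
        (∀ x ∈ X, ¬ (openGraph ω).Reachable s x) ∧ 𝒰 {v | (openGraph ω).Reachable s v}} := by
    ext ω
    simp only [Φ₄, Set.mem_inter_iff, Set.mem_setOf_eq, hRs, hball, openConn]
    constructor
    · rintro ⟨⟨hsy, hsz, hU⟩, hsX, -⟩
      exact ⟨hsy, hsz, hsX, hU⟩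
    · rintro ⟨hsy, hsz, hsX, hU⟩
      exact ⟨⟨hsy, hsz, hU⟩, hsX, fun x hx h' => hsX x hx (hsy.trans h')⟩
  rw [e1, e2, e3, e4] at key
  exact key

/-- **Generator `G₃` (the same exchange with the rider `y ↮ s` on the meet side).**  For a monotone vertex-up-family `𝒰`:
`μ(z ∈ C_s ∪ C_y, y↮s, s↮X, y↮X) · μ(s↔y, s↮X, 𝒰(V C_s)) ≤ μ(y↮s, s↮X, y↮X) · μ(s↔y, s↔z, s↮X, 𝒰(V C_s))`.
[cite: VandenbergHaggstromKahn2005, Thm. 1.1 and its proof (pp. 3–5) — instance of `Consts.localEv_fourEvents`, derived here] -/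
theorem markerPinned_exchange_G3 (s y z : V) (X : Set V) {𝒰 : Set V → Prop} (h𝒰 : Monotone 𝒰) :
    (prodBernoulli w).real {ω : BondConfig V | ((openGraph ω).Reachable s z ∨ (openGraph ω).Reachable y z) ∧
        ¬ (openGraph ω).Reachable y s ∧
        (∀ x ∈ X, ¬ (openGraph ω).Reachable y x) ∧ (∀ x ∈ X, ¬ (openGraph ω).Reachable s x)} *
      (prodBernoulli w).real {ω : BondConfig V | (openGraph ω).Reachable s y ∧ (∀ x ∈ X, ¬ (openGraph ω).Reachable s x) ∧
        𝒰 {v | (openGraph ω).Reachable s v}} ≤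
    (prodBernoulli w).real {ω : BondConfig V | ¬ (openGraph ω).Reachable y s ∧
        (∀ x ∈ X, ¬ (openGraph ω).Reachable y x) ∧ (∀ x ∈ X, ¬ (openGraph ω).Reachable s x)} *
      (prodBernoulli w).real {ω : BondConfig V | (openGraph ω).Reachable s y ∧ (openGraph ω).Reachable s z ∧
        (∀ x ∈ X, ¬ (openGraph ω).Reachable s x) ∧ 𝒰 {v | (openGraph ω).Reachable s v}} := by
  set S : Finset V := {s, y} with hSdef
  have hsS : s ∈ S := by simp [hSdef]
  have hyS : y ∈ S := by simp [hSdef]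
  have hRs : ∀ ω : BondConfig V, reachOf S ω s = {v | (openGraph ω).Reachable s v} := fun ω => reachOf_apply' hsS
  have hRy : ∀ ω : BondConfig V, reachOf S ω y = {v | (openGraph ω).Reachable y v} := fun ω => reachOf_apply' hyS
  have hball : ∀ (P : V → Prop), (∀ s' ∈ S, P s') ↔ (P s ∧ P y) := fun P => by
    simp only [hSdef, Finset.mem_insert, Finset.mem_singleton, forall_eq_or_imp, forall_eq]
  let Φ₁ : (V → Set V) → Prop := fun R => (z ∈ R s ∨ z ∈ R y) ∧ s ∉ R y
  let Φ₂ : (V → Set V) → Prop := fun R => y ∈ R s ∧ 𝒰 (R s)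
  let Φ₃ : (V → Set V) → Prop := fun R => s ∉ R y
  let Φ₄ : (V → Set V) → Prop := fun R => y ∈ R s ∧ z ∈ R s ∧ 𝒰 (R s)
  have hAD : ∀ ω ω' : BondConfig V, Φ₁ (reachOf S ω) → Φ₂ (reachOf S ω') →
      Φ₃ (reachOf (S ∩ S) (ω ∩ ω')) ∧ Φ₄ (reachOf (S ∪ S) (ω ∪ ω')) := by
    intro ω ω' h1 h2
    simp only [Φ₁, Φ₂, Φ₃, Φ₄, Finset.inter_self, Finset.union_self, hRs, hRy, Set.mem_setOf_eq] at h1 h2 ⊢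
    obtain ⟨hz, hys⟩ := h1
    obtain ⟨hsy, hU⟩ := h2
    refine ⟨fun h => hys (reach_mono' Set.inter_subset_left h), reach_mono' Set.subset_union_right hsy, ?_,
      h𝒰 (fun v (hv : (openGraph ω').Reachable s v) => reach_mono' Set.subset_union_right hv) hU⟩
    rcases hz with hsz | hyz
    · exact reach_mono' Set.subset_union_left hsz
    · exact (reach_mono' Set.subset_union_right hsy).trans (reach_mono' Set.subset_union_left hyz)
  have key := localEv_fourEvents w S S hAD X X
  rw [Finset.inter_self, Finset.union_self, Set.union_self, Set.inter_self] at key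
  have e1 : ({ω : BondConfig V | Φ₁ (reachOf S ω)} ∩ {ω | ∀ s' ∈ S, ∀ x ∈ X, ω ∉ openConn s' x}) =
      {ω : BondConfig V | ((openGraph ω).Reachable s z ∨ (openGraph ω).Reachable y z) ∧
        ¬ (openGraph ω).Reachable y s ∧
        (∀ x ∈ X, ¬ (openGraph ω).Reachable y x) ∧ (∀ x ∈ X, ¬ (openGraph ω).Reachable s x)} := by
    ext ω
    simp only [Φ₁, Set.mem_inter_iff, Set.mem_setOf_eq, hRs, hRy, hball, openConn]
    tauto
  have e2 : ({ω : BondConfig V | Φ₂ (reachOf S ω)} ∩ {ω | ∀ s' ∈ S, ∀ x ∈ X, ω ∉ openConn s' x}) =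
      {ω : BondConfig V | (openGraph ω).Reachable s y ∧ (∀ x ∈ X, ¬ (openGraph ω).Reachable s x) ∧
        𝒰 {v | (openGraph ω).Reachable s v}} := by
    ext ω
    simp only [Φ₂, Set.mem_inter_iff, Set.mem_setOf_eq, hRs, hball, openConn]
    constructor
    · rintro ⟨⟨hsy, hU⟩, hsX, -⟩
      exact ⟨hsy, hsX, hU⟩
    · rintro ⟨hsy, hsX, hU⟩
      exact ⟨⟨hsy, hU⟩, hsX, fun x hx h' => hsX x hx (hsy.trans h')⟩
  have e3 : ({ω : BondConfig V | Φ₃ (reachOf S ω)} ∩ {ω | ∀ s' ∈ S, ∀ x ∈ X, ω ∉ openConn s' x}) =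
      {ω : BondConfig V | ¬ (openGraph ω).Reachable y s ∧
        (∀ x ∈ X, ¬ (openGraph ω).Reachable y x) ∧ (∀ x ∈ X, ¬ (openGraph ω).Reachable s x)} := by
    ext ω
    simp only [Φ₃, Set.mem_inter_iff, Set.mem_setOf_eq, hRy, hball, openConn]
    tauto
  have e4 : ({ω : BondConfig V | Φ₄ (reachOf S ω)} ∩ {ω | ∀ s' ∈ S, ∀ x ∈ X, ω ∉ openConn s' x}) =
      {ω : BondConfig V | (openGraph ω).Reachable s y ∧ (openGraph ω).Reachable s z ∧
        (∀ x ∈ X, ¬ (openGraph ω).Reachable s x) ∧ 𝒰 {v | (openGraph ω).Reachable s v}} := by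
    ext ω
    simp only [Φ₄, Set.mem_inter_iff, Set.mem_setOf_eq, hRs, hball, openConn]
    constructor
    · rintro ⟨⟨hsy, hsz, hU⟩, hsX, -⟩
      exact ⟨hsy, hsz, hsX, hU⟩
    · rintro ⟨hsy, hsz, hsX, hU⟩
      exact ⟨⟨hsy, hsz, hU⟩, hsX, fun x hx h' => hsX x hx (hsy.trans h')⟩
  rw [e1, e2, e3, e4] at key
  exact key

/-- **CROSS member `M₂` at `u = z` on the marker-pinned class, unconditionally** (`…CrossReachMarkerPinned`'s theorem with its three exchange
hypotheses discharged by `markerPinned_exchange_G1/G2/G3`). [cite: VandenbergHaggstromKahn2005, Thm. 1.1 (pp. 3–5), Thm. 1.4 (p. 7)] -/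
theorem crossRel_reach_M2_of_markerPinned (s y z : V) (X : Set V) {𝒰 : Set V → Prop} (h𝒰 : Monotone 𝒰)
    (h𝒰y : ∀ S : Set V, 𝒰 S → y ∈ S) (F : Set (Sym2 V) → ℝ)
    (hF : ∀ ω : BondConfig V, F (openEdgeCluster ω s) = if 𝒰 {v | (openGraph ω).Reachable s v} then 1 else 0) :
    0 ≤ polMargin (prodBernoulli w) s y z F (insert z X) (insert z X) X +
          polMargin (prodBernoulli w) s y z F (insert z X) X (insert z X) +
        polMargin (prodBernoulli w) s y z F X (insert z X) (insert z X) := by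
  have g1 := markerPinned_exchange_G1 w s y z X h𝒰
  have g2 := markerPinned_exchange_G2 w s y z X h𝒰
  have g3 := markerPinned_exchange_G3 w s y z X h𝒰
  -- identify the set-builder events with the intersections used by the core theorem
  have e_YU : {ω : BondConfig V | (openGraph ω).Reachable s y ∧ (∀ x ∈ X, ¬ (openGraph ω).Reachable s x) ∧
        𝒰 {v | (openGraph ω).Reachable s v}} =
      {ω : BondConfig V | ∀ x ∈ X, ¬ (openGraph ω).Reachable s x} ∩ openConn s y ∩ {ω | 𝒰 {v | (openGraph ω).Reachable s v}} := by
    ext ω; simp only [Set.mem_inter_iff, Set.mem_setOf_eq, openConn]; tauto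
  have e_TW : {ω : BondConfig V | (openGraph ω).Reachable y z ∧ ¬ (openGraph ω).Reachable y s ∧
        (∀ x ∈ X, ¬ (openGraph ω).Reachable y x) ∧ (∀ x ∈ X, ¬ (openGraph ω).Reachable s x)} =
      {ω : BondConfig V | ∀ x ∈ insert s X, ¬ (openGraph ω).Reachable y x} ∩
        {ω | ∀ x ∈ X, ¬ (openGraph ω).Reachable s x} ∩ openConn y z := by
    ext ω; simp only [Set.mem_inter_iff, Set.mem_setOf_eq, Set.forall_mem_insert, openConn]; tauto
  have e_TZc : {ω : BondConfig V | ¬ (openGraph ω).Reachable y s ∧ ¬ (openGraph ω).Reachable s z ∧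
        (∀ x ∈ X, ¬ (openGraph ω).Reachable y x) ∧ (∀ x ∈ X, ¬ (openGraph ω).Reachable s x)} =
      ({ω : BondConfig V | ∀ x ∈ insert s X, ¬ (openGraph ω).Reachable y x} ∩
        {ω | ∀ x ∈ X, ¬ (openGraph ω).Reachable s x}) \ openConn s z := by
    ext ω; simp only [Set.mem_inter_iff, Set.mem_sdiff, Set.mem_setOf_eq, Set.forall_mem_insert, openConn]; tauto
  have e_YZU : {ω : BondConfig V | (openGraph ω).Reachable s y ∧ (openGraph ω).Reachable s z ∧
        (∀ x ∈ X, ¬ (openGraph ω).Reachable s x) ∧ 𝒰 {v | (openGraph ω).Reachable s v}} =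
      {ω : BondConfig V | ∀ x ∈ X, ¬ (openGraph ω).Reachable s x} ∩ openConn s y ∩
        {ω | 𝒰 {v | (openGraph ω).Reachable s v}} ∩ openConn s z := by
    ext ω; simp only [Set.mem_inter_iff, Set.mem_setOf_eq, openConn]; tauto
  have e_1z : {ω : BondConfig V | ((openGraph ω).Reachable s z ∨ (openGraph ω).Reachable y z) ∧
        (∀ x ∈ X, ¬ (openGraph ω).Reachable y x) ∧ (∀ x ∈ X, ¬ (openGraph ω).Reachable s x)} =
      {ω : BondConfig V | ∀ x ∈ X, ¬ (openGraph ω).Reachable y x} ∩ {ω | ∀ x ∈ X, ¬ (openGraph ω).Reachable s x} ∩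
        (openConn s z ∪ openConn y z) := by
    ext ω; simp only [Set.mem_inter_iff, Set.mem_union, Set.mem_setOf_eq, openConn]; tauto
  have e_1 : {ω : BondConfig V | (∀ x ∈ X, ¬ (openGraph ω).Reachable y x) ∧ (∀ x ∈ X, ¬ (openGraph ω).Reachable s x)} =
      {ω : BondConfig V | ∀ x ∈ X, ¬ (openGraph ω).Reachable y x} ∩ {ω | ∀ x ∈ X, ¬ (openGraph ω).Reachable s x} := by
    ext ω; simp only [Set.mem_inter_iff, Set.mem_setOf_eq]
  have e_Tz : {ω : BondConfig V | ((openGraph ω).Reachable s z ∨ (openGraph ω).Reachable y z) ∧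
        ¬ (openGraph ω).Reachable y s ∧
        (∀ x ∈ X, ¬ (openGraph ω).Reachable y x) ∧ (∀ x ∈ X, ¬ (openGraph ω).Reachable s x)} =
      {ω : BondConfig V | ∀ x ∈ insert s X, ¬ (openGraph ω).Reachable y x} ∩ {ω | ∀ x ∈ X, ¬ (openGraph ω).Reachable s x} ∩
        (openConn s z ∪ openConn y z) := by
    ext ω; simp only [Set.mem_inter_iff, Set.mem_union, Set.mem_setOf_eq, Set.forall_mem_insert, openConn]; tauto
  have e_T : {ω : BondConfig V | ¬ (openGraph ω).Reachable y s ∧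
        (∀ x ∈ X, ¬ (openGraph ω).Reachable y x) ∧ (∀ x ∈ X, ¬ (openGraph ω).Reachable s x)} =
      {ω : BondConfig V | ∀ x ∈ insert s X, ¬ (openGraph ω).Reachable y x} ∩ {ω | ∀ x ∈ X, ¬ (openGraph ω).Reachable s x} := by
    ext ω; simp only [Set.mem_inter_iff, Set.mem_setOf_eq, Set.forall_mem_insert]; tauto
  rw [e_YU, e_TW, e_TZc, e_YZU] at g1
  rw [e_1z, e_YU, e_1, e_YZU] at g2
  rw [e_Tz, e_YU, e_T, e_YZU] at g3
  exact crossRel_reach_M2_of_markerPinned_of_exchanges w s y z X h𝒰y F hF g1 g2 g3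

end Consts

end Summit.CriticalPhenomena.PercolationContinuityZ3.Theorems

end
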